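import Literature.RingTheory.JacobsonRadical.UnitIndexModuloConductor   -- ★ p845488 (FILE 1∕3): `index_range_units_map_mul_natCard_units_quotient`, `natCard_units_mul_natCard_residueField`, `natCard_residueField_quotient_eq`
import Literature.NumberTheory.Automorphic.LatticeIndexGL                    -- ★ `IsUniformizingElement`, `natCard_quotient_span_pow` (brings ★ `HeckeTransversalGL`: `𝒪[F]`, `𝓀[F]`, `valuation F`)
import HarnessLib

/-!
# The unit index of a local order in `𝒪ⁿ`: `[(𝒪^×)ⁿ : R^×] · q^{n−1} = (q − 1)^{n−1} · [𝒪ⁿ : R]` — T3′ organ O2 «UNIT INDEX OF A LOCAL ORDER»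
# (Neukirch, *Algebraic Number Theory*, Ch. I §12; Rogawski (1990) §4.9, where the count is consumed)

Topic `NumberTheory/Automorphic`; namespace `Literature.NumberTheory.Automorphic`.  THEOREMS ONLY (no definition, no instance, no notation, no named fact, no `sorry`); generic
`[Field F] [ValuativeRel F]` = (D0) ∕ ★ `FixedCosetsStableLattices` ∕ ★ `LatticeIndexGL` currency (`𝒪 = 𝒪[F]`, `𝓀 = 𝓀[F]`, `q = Nat.card 𝓀[F]`), any `n`.  Cell `pub/hodgecm-mathlib`
(D-0151), crux H413 = `stmt-HodgeConjecture-24833`; road «S3-tree» (LEAD F0P3a-plan (g11) T10-2 ∕ T10-15), brick T3′ «DEPTH-ZERO κ-TRANSFER» (holder F0P3b-p01 (g11), DESIGN v1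
419b4e54 §2), organ **O2** (architect A-p16 (g29) A-61 (1) ∕ A-62 (1) ∕ A-63 (2) → F0P3-p02 (g14); statement-first heads 666ea884 «=» ref5 (g0) R-2).  HONEST LABEL: HC_CM is proved
only modulo the printed citations (2 remaining named inputs hLiu418 24832, h413 24833) until rung 0 closes; this file is commutative algebra of orders and asserts nothing printed.

THE MATHEMATICS.  The eigen-coordinate algebra of a regular semisimple `γ` with eigenvalues in `F` is `A = Fⁿ` with maximal order `𝒪_A = 𝒪ⁿ` (the Pi ring `Fin n → 𝒪[F]`); an ORDER
is a subring `R ≤ 𝒪ⁿ` containing the constants `𝒪·1` of finite additive index (in T3′: `R₀ = 𝒪_w[γ]`, DESIGN §1).  (§1) If `R` is LOCAL, its residue field is `𝓀` (the first-coordinate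
residue map is onto with maximal kernel).  (§2) The conductor contains `𝔣 = ϖ^m𝒪ⁿ` for some `m ≥ 1` (`𝒪ⁿ∕R` is a finite `𝒪`-module).  (§3) `𝒪ⁿ⧸ϖ^m𝒪ⁿ ≅ (𝒪⧸ϖ^m)ⁿ` has `q^{mn}`
elements and `(q^{m−1}(q−1))ⁿ` units.  (§4) Feeding these into the dévissage ★ `index_range_units_map_mul_natCard_units_quotient` (`[(𝒪^×)ⁿ : R^×]·#(R⧸𝔣)^× = #(𝒪ⁿ⧸𝔣)^×`) and the
finite-local-ring count ★ `natCard_units_mul_natCard_residueField` (`#(R⧸𝔣)^×·q = #(R⧸𝔣)(q−1)`, `#(R⧸𝔣)·[𝒪ⁿ:R] = q^{mn}`) and eliminating `m`: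
**`[(𝒪^×)ⁿ : R^×] · q^{n−1} = (q−1)^{n−1} · [𝒪ⁿ : R]`**, i.e. for `[𝒪ⁿ : R] = q^S`: `[(𝒪^×)ⁿ : R^×] = (q−1)^{n−1} q^{S−n+1}` (DESIGN §2 O2 verbatim; at `𝒪_E`, `q_E = q²`:
`(q²−1)²q^{2S−4}` for `n = 3`).  The LOCALITY of the monogenic order `𝒪[γ]` of a deep `γ` (§4's hypothesis) and the composite O1 ∘ O2 are in FILE 3∕3
`VandermondeLatticeIndex`.

* §1 `natCard_residueField_subring_pi_eq`; §2 `exists_forall_pow_dvd_imp_mem`; §3 `natCard_quotient_span_const_pow`, `natCard_units_quotient_span_uniformizer_pow`,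
  `natCard_units_quotient_span_const_pow`; §4 **`index_range_units_map_mul_pow_eq`**, **`index_range_units_map_eq_of_index_eq_pow`**.

## References
* [Neukirch1999] J. Neukirch, *Algebraic Number Theory*, Grundlehren 322 (1999): Ch. I §12 (orders `𝒪 ⊆ 𝒪_K`, conductor, `[𝒪_K^× : 𝒪^×]`, `#(𝒪_K⧸𝔣)^× ∕ #(𝒪⧸𝔣)^×`).
* [Macdonald1995] I. G. Macdonald, *Symmetric Functions and Hall Polynomials*, 2nd ed. (1995): Ch. II §1 (1.4) (finite `𝔬`-modules, `|𝔬⧸𝔭^m| = q^m`).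
* [Hungerford1974] T. W. Hungerford, *Algebra*, GTM 73 (1974): Ch. I Thm. 4.5, Ch. III Thms. 2.5, 2.9.
* [Rogawski1990] J. D. Rogawski, *Automorphic Representations of Unitary Groups in Three Variables* (1990): §4.9 Lemma 4.9.3 p. 56 (where the count is consumed).
-/

set_option autoImplicit false

noncomputable section

open scoped ValuativeRel

namespace Literature.NumberTheory.Automorphic

open Literature.RingTheory.JacobsonRadical

variable {F : Type*} [Field F] [ValuativeRel F] {n : ℕ}

/-! ## §1 Local subrings of `𝒪ⁿ` containing the constants have residue field `𝓀` -/

section ResidueField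

/-- A local subring of `𝒪ⁿ` forces `n ≥ 1` (`𝒪⁰` is the zero ring). [cite: Neukirch1999, Ch. I §12] -/
theorem pos_of_isLocalRing_subring_pi (R : Subring (Fin n → 𝒪[F])) [IsLocalRing R] : 0 < n := by
  rcases Nat.eq_zero_or_pos n with h | h
  · subst h
    exfalso
    have : Subsingleton R := ⟨fun a b => Subtype.ext (Subsingleton.elim _ _)⟩
    exact not_subsingleton R this
  · exact h

/-- **The residue field of a local subring `R ≤ 𝒪ⁿ` containing the constants is `𝓀`**: the first-coordinate residue map `R → 𝓀` is onto (constants) with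
maximal kernel, which in a local ring is `𝔪_R` — DESIGN v1 §2 O2's clause «`R∕(R ∩ ϖ𝒪ⁿ) ≅ k` via the diagonal» is automatic. [cite: Neukirch1999, Ch. I §12] -/
theorem natCard_residueField_subring_pi_eq (R : Subring (Fin n → 𝒪[F])) [IsLocalRing R]
    (hconst : ∀ a : 𝒪[F], (fun _ : Fin n => a) ∈ R) :
    Nat.card (IsLocalRing.ResidueField R) = Nat.card 𝓀[F] := by
  have hn : 0 < n := pos_of_isLocalRing_subring_pi R
  set i₀ : Fin n := ⟨0, hn⟩
  set ψ : R →+* 𝓀[F] := (IsLocalRing.residue 𝒪[F]).comp ((Pi.evalRingHom (fun _ : Fin n => 𝒪[F]) i₀).comp R.subtype) with hψ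
  have hψs : Function.Surjective ψ := by
    intro t
    obtain ⟨a, rfl⟩ := IsLocalRing.residue_surjective t
    exact ⟨⟨fun _ => a, hconst a⟩, rfl⟩
  have hmax : (RingHom.ker ψ).IsMaximal := RingHom.ker_isMaximal_of_surjective ψ hψs
  have hker : RingHom.ker ψ = IsLocalRing.maximalIdeal R := IsLocalRing.eq_maximalIdeal hmax
  unfold IsLocalRing.ResidueField
  rw [Nat.card_congr (Ideal.quotEquivOfEq hker.symm).toEquiv, Nat.card_congr (RingHom.quotientKerEquivOfSurjective hψs).toEquiv]
  rfl

end ResidueField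

/-! ## §2 The conductor contains `ϖ^m 𝒪ⁿ` -/

section Conductor

/-- Membership in the principal ideal `c·𝒪ⁿ` of `𝒪ⁿ` generated by a constant is coordinatewise divisibility. [cite: Hungerford1974, Ch. III Thm. 2.5] -/
theorem mem_span_const_iff (c : 𝒪[F]) (x : Fin n → 𝒪[F]) :
    x ∈ Ideal.span ({fun _ : Fin n => c} : Set (Fin n → 𝒪[F])) ↔ ∀ i, c ∣ x i := by
  rw [Ideal.mem_span_singleton]
  constructor
  · rintro ⟨y, hy⟩ i
    exact ⟨y i, congrFun hy i⟩
  · intro h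
    choose y hy using h
    exact ⟨y, funext hy⟩

/-- **THE CONDUCTOR CONTAINS `ϖ^m 𝒪ⁿ`.**  If `R ≤ 𝒪ⁿ` is a subring containing the constants (hence an `𝒪`-submodule) of finite additive index, then some
`ϖ'^m 𝒪ⁿ ⊆ R` with `m ≥ 1`, for any `ϖ' ∈ 𝔪`: every class of the finite `𝒪`-module `𝒪ⁿ ∕ R` is killed by a power of `ϖ'` (two of `ϖ'^k z̄` coincide and
`1 − ϖ'^d` is a unit), and `m = 1 + max` over the finitely many classes. [cite: Neukirch1999, Ch. I §12] -/
theorem exists_forall_pow_dvd_imp_mem {ϖ' : 𝒪[F]} (hϖ' : ϖ' ∈ IsLocalRing.maximalIdeal 𝒪[F])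
    (R : Subring (Fin n → 𝒪[F])) (hconst : ∀ a : 𝒪[F], (fun _ : Fin n => a) ∈ R) (hfin : R.toAddSubgroup.index ≠ 0) :
    ∃ m : ℕ, 0 < m ∧ ∀ x : Fin n → 𝒪[F], (∀ i, ϖ' ^ m ∣ x i) → x ∈ R := by
  classical
  -- `R` as an `𝒪`-submodule of `𝒪ⁿ`
  let RM : Submodule 𝒪[F] (Fin n → 𝒪[F]) :=
    { carrier := R
      add_mem' := fun ha hb => R.add_mem ha hb
      zero_mem' := R.zero_mem
      smul_mem' := fun a x hx => by
        have h := R.mul_mem (hconst a) hx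
        have : a • x = (fun _ : Fin n => a) * x := funext fun i => rfl
        rw [this]; exact h }
  have hRM : RM.toAddSubgroup = R.toAddSubgroup := by ext x; rfl
  haveI : Finite ((Fin n → 𝒪[F]) ⧸ RM) := by
    apply Nat.finite_of_card_ne_zero
    change RM.toAddSubgroup.index ≠ 0
    rwa [hRM]
  -- every class is killed by a power of `ϖ'`
  have hkill : ∀ z : (Fin n → 𝒪[F]) ⧸ RM, ∃ a : ℕ, ϖ' ^ a • z = 0 := by
    intro z
    obtain ⟨a, b, hab, heq⟩ := Finite.exists_ne_map_eq_of_infinite (fun k : ℕ => ϖ' ^ k • z)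
    wlog hlt : a < b generalizing a b
    · exact this b a hab.symm heq.symm (lt_of_le_of_ne (not_lt.1 hlt) hab.symm)
    refine ⟨a, ?_⟩
    obtain ⟨d, rfl⟩ := Nat.exists_eq_add_of_lt hlt
    -- `ϖ'^a z = ϖ'^(a+d+1) z` ⇒ `(1 - ϖ'^(d+1)) ϖ'^a z = 0`, and `1 - ϖ'^(d+1)` is a unit
    have hu : IsUnit (1 - ϖ' ^ (d + 1)) := by
      apply IsLocalRing.isUnit_one_sub_self_of_mem_nonunits
      rw [← IsLocalRing.mem_maximalIdeal]
      exact Ideal.pow_mem_of_mem _ hϖ' _ (Nat.succ_pos d)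
    have h0 : (1 - ϖ' ^ (d + 1)) • (ϖ' ^ a • z) = 0 := by
      rw [sub_smul, one_smul, ← mul_smul, ← pow_add, show d + 1 + a = a + d + 1 by ring, ← heq, sub_self]
    have := congrArg (fun w => ((hu.unit⁻¹ : (𝒪[F])ˣ) : 𝒪[F]) • w) h0
    simpa only [smul_zero, ← mul_smul, ← mul_assoc, IsUnit.val_inv_mul, one_mul] using this
  choose a ha using hkill
  haveI := Fintype.ofFinite ((Fin n → 𝒪[F]) ⧸ RM)
  refine ⟨Finset.univ.sup a + 1, Nat.succ_pos _, fun x hx => ?_⟩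
  choose y hy using hx
  have hxy : x = (ϖ' ^ (Finset.univ.sup a + 1)) • (fun i => y i) := by
    funext i; rw [Pi.smul_apply, smul_eq_mul]; exact hy i
  have hz : (Submodule.Quotient.mk x : (Fin n → 𝒪[F]) ⧸ RM) = 0 := by
    rw [hxy, Submodule.Quotient.mk_smul]
    set z : (Fin n → 𝒪[F]) ⧸ RM := Submodule.Quotient.mk (fun i => y i)
    have hle : a z ≤ Finset.univ.sup a + 1 := (Finset.le_sup (Finset.mem_univ z)).trans (Nat.le_succ _)
    obtain ⟨e, he⟩ := Nat.exists_eq_add_of_le hle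
    rw [he, add_comm, pow_add, mul_smul, ha z, smul_zero]
  have : x ∈ RM := (Submodule.Quotient.mk_eq_zero RM).1 hz
  exact this

end Conductor

/-! ## §3 `𝒪ⁿ ⧸ ϖ^m 𝒪ⁿ`: cardinality and units -/

section PiQuotient

/-- `𝒪ⁿ ⧸ c·𝒪ⁿ ≃ (𝒪 ⧸ c)ⁿ` as rings (coordinatewise reduction is onto with kernel `c·𝒪ⁿ`). [cite: Hungerford1974, Ch. III Thm. 2.9] -/
theorem exists_ringEquiv_quotient_span_const (c : 𝒪[F]) :
    Nonempty (((Fin n → 𝒪[F]) ⧸ Ideal.span ({fun _ : Fin n => c} : Set (Fin n → 𝒪[F]))) ≃+*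
      (Fin n → 𝒪[F] ⧸ Ideal.span ({c} : Set 𝒪[F]))) := by
  set f : (Fin n → 𝒪[F]) →+* (Fin n → 𝒪[F] ⧸ Ideal.span ({c} : Set 𝒪[F])) :=
    RingHom.pi fun i => (Ideal.Quotient.mk _).comp (Pi.evalRingHom (fun _ : Fin n => 𝒪[F]) i) with hf
  have hfs : Function.Surjective f := by
    intro y
    choose x hx using fun i => Ideal.Quotient.mk_surjective (y i)
    exact ⟨x, funext fun i => hx i⟩
  have hker : RingHom.ker f = Ideal.span ({fun _ : Fin n => c} : Set (Fin n → 𝒪[F])) := by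
    ext x
    rw [RingHom.mem_ker, mem_span_const_iff, funext_iff]
    refine forall_congr' fun i => ?_
    rw [Pi.zero_apply]
    change Ideal.Quotient.mk _ (x i) = 0 ↔ _
    rw [Ideal.Quotient.eq_zero_iff_mem, Ideal.mem_span_singleton]
  exact ⟨(Ideal.quotEquivOfEq hker.symm).trans (RingHom.quotientKerEquivOfSurjective hfs)⟩

variable {ϖ : F} (hϖ : IsUniformizingElement ϖ)
include hϖ

/-- `#(𝒪ⁿ ⧸ ϖ^m 𝒪ⁿ) = q^{mn}` (★ `natCard_quotient_span_pow`: `#(𝒪 ⧸ ϖ^m) = q^m`). [cite: Macdonald1995, Ch. II §1 (1.4)] -/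
theorem natCard_quotient_span_const_pow (m : ℕ) :
    Nat.card ((Fin n → 𝒪[F]) ⧸ Ideal.span ({fun _ : Fin n => (⟨ϖ, hϖ.mem⟩ : 𝒪[F]) ^ m} : Set (Fin n → 𝒪[F]))) =
      Nat.card 𝓀[F] ^ (m * n) := by
  obtain ⟨e⟩ := exists_ringEquiv_quotient_span_const (n := n) ((⟨ϖ, hϖ.mem⟩ : 𝒪[F]) ^ m)
  rw [Nat.card_congr e.toEquiv, Nat.card_fun, natCard_quotient_span_pow hϖ m, Nat.card_eq_fintype_card (α := Fin n), Fintype.card_fin,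
    ← pow_mul]

/-- `#(𝒪 ⧸ ϖ^m)^× = q^{m−1}(q − 1)` for `m ≥ 1` (finite local ring with residue field `𝓀`). [cite: Neukirch1999, Ch. I §12] -/
theorem natCard_units_quotient_span_uniformizer_pow [Finite 𝓀[F]] {m : ℕ} (hm : 0 < m) :
    Nat.card (𝒪[F] ⧸ Ideal.span ({(⟨ϖ, hϖ.mem⟩ : 𝒪[F]) ^ m} : Set 𝒪[F]))ˣ = Nat.card 𝓀[F] ^ (m - 1) * (Nat.card 𝓀[F] - 1) := by
  set I : Ideal 𝒪[F] := Ideal.span ({(⟨ϖ, hϖ.mem⟩ : 𝒪[F]) ^ m} : Set 𝒪[F]) with hI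
  have hq : 1 < Nat.card 𝓀[F] := Finite.one_lt_card
  have hcard : Nat.card (𝒪[F] ⧸ I) = Nat.card 𝓀[F] ^ m := natCard_quotient_span_pow hϖ m
  haveI : Finite (𝒪[F] ⧸ I) := Nat.finite_of_card_ne_zero (by rw [hcard]; exact pow_ne_zero _ (by omega))
  have hIle : I ≤ IsLocalRing.maximalIdeal 𝒪[F] := by
    rw [hI, ← hϖ.span_coe_eq_maximalIdeal, Ideal.span_singleton_le_span_singleton]
    exact dvd_pow_self _ hm.ne'
  have hItop : I ≠ ⊤ := fun h => IsLocalRing.maximalIdeal.isMaximal 𝒪[F] |>.ne_top (top_le_iff.1 (h ▸ hIle))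
  haveI : Nontrivial (𝒪[F] ⧸ I) := Ideal.Quotient.nontrivial_iff.2 hItop
  haveI : IsLocalRing (𝒪[F] ⧸ I) := IsLocalRing.of_surjective' (Ideal.Quotient.mk I) Ideal.Quotient.mk_surjective
  have hres : Nat.card (IsLocalRing.ResidueField (𝒪[F] ⧸ I)) = Nat.card 𝓀[F] := natCard_residueField_quotient_eq I
  have key := natCard_units_mul_natCard_residueField (Λ := 𝒪[F] ⧸ I)
  rw [hres, hcard] at key
  -- `#Λˣ · q = q^m (q − 1)` ⇒ `#Λˣ = q^{m−1} (q − 1)`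
  obtain ⟨m', rfl⟩ := Nat.exists_eq_add_of_le hm
  have : Nat.card (𝒪[F] ⧸ I)ˣ * Nat.card 𝓀[F] = (Nat.card 𝓀[F] ^ m' * (Nat.card 𝓀[F] - 1)) * Nat.card 𝓀[F] := by
    rw [key]; ring
  rw [Nat.add_sub_cancel_left]
  exact Nat.eq_of_mul_eq_mul_right (by omega) this

/-- `#(𝒪ⁿ ⧸ ϖ^m 𝒪ⁿ)^× = (q^{m−1}(q − 1))ⁿ` for `m ≥ 1` (units of a product). [cite: Neukirch1999, Ch. I §12] -/
theorem natCard_units_quotient_span_const_pow [Finite 𝓀[F]] {m : ℕ} (hm : 0 < m) :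
    Nat.card ((Fin n → 𝒪[F]) ⧸ Ideal.span ({fun _ : Fin n => (⟨ϖ, hϖ.mem⟩ : 𝒪[F]) ^ m} : Set (Fin n → 𝒪[F])))ˣ =
      (Nat.card 𝓀[F] ^ (m - 1) * (Nat.card 𝓀[F] - 1)) ^ n := by
  obtain ⟨e⟩ := exists_ringEquiv_quotient_span_const (n := n) ((⟨ϖ, hϖ.mem⟩ : 𝒪[F]) ^ m)
  rw [Nat.card_congr (Units.mapEquiv e.toMulEquiv).toEquiv, Nat.card_congr (MulEquiv.piUnits).toEquiv, Nat.card_fun,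
    natCard_units_quotient_span_uniformizer_pow hϖ hm, Nat.card_eq_fintype_card (α := Fin n), Fintype.card_fin]

end PiQuotient

/-! ## §4 O2: the unit index of a local order -/

section UnitIndex

/-- Additive dévissage `#(R ⧸ 𝔣 ∩ R) · [𝒪ⁿ : R] = #(𝒪ⁿ ⧸ 𝔣)` for an ideal `𝔣 ⊆ R` (Mathlib `AddSubgroup.relIndex_mul_index`). [cite: Hungerford1974, Ch. I Thm. 4.5] -/
theorem natCard_quotient_comap_subtype_mul_index (R : Subring (Fin n → 𝒪[F])) (𝔣 : Ideal (Fin n → 𝒪[F]))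
    (h𝔣R : (𝔣 : Set (Fin n → 𝒪[F])) ⊆ R) :
    Nat.card (R ⧸ Ideal.comap R.subtype 𝔣) * R.toAddSubgroup.index = Nat.card ((Fin n → 𝒪[F]) ⧸ 𝔣) := by
  have hle : 𝔣.toAddSubgroup ≤ R.toAddSubgroup := fun x hx => h𝔣R hx
  have h := AddSubgroup.relIndex_mul_index hle
  have hrange : (R.subtype.toAddMonoidHom).range = R.toAddSubgroup := by
    ext x
    constructor
    · rintro ⟨y, rfl⟩; exact y.2
    · intro hx; exact ⟨⟨x, hx⟩, rfl⟩
  have hcomap : 𝔣.toAddSubgroup.comap R.subtype.toAddMonoidHom = (Ideal.comap R.subtype 𝔣).toAddSubgroup := by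
    ext x; rfl
  have hrel : 𝔣.toAddSubgroup.relIndex R.toAddSubgroup = Nat.card (R ⧸ Ideal.comap R.subtype 𝔣) := by
    rw [← hrange, ← AddSubgroup.index_comap, hcomap]
    rfl
  rw [hrel] at h
  exact h

/-- **O2 «UNIT INDEX OF A LOCAL ORDER» (DESIGN v1 §2), division-free form.**  `𝒪 = 𝒪[F]` a discrete valuation ring with finite residue field `𝓀`, `q = #𝓀`;
`R ≤ 𝒪ⁿ` a LOCAL subring containing the constants, of finite additive index.  Then
**`[(𝒪^×)ⁿ : R^×] · q^{n−1} = (q − 1)^{n−1} · [𝒪ⁿ : R]`.**  Proof: pick `𝔣 = ϖ^m𝒪ⁿ ⊆ R` (`exists_forall_pow_dvd_imp_mem`); by the dévissage ★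
`index_range_units_map_mul_natCard_units_quotient`, `[(𝒪^×)ⁿ : R^×]·#(R⧸𝔣)^× = #(𝒪ⁿ⧸𝔣)^× = (q^{m−1}(q−1))ⁿ`; `R⧸𝔣` is a finite local ring with residue field `𝓀` and
`#(R⧸𝔣)·[𝒪ⁿ : R] = q^{mn}`, so `#(R⧸𝔣)^×·q = #(R⧸𝔣)(q−1)`; eliminate.  (`R^×` is read as the subgroup `(Units.map R.subtype).range ≤ (𝒪ⁿ)^×`, i.e. `R ∩ (𝒪^×)ⁿ`.)
[cite: Neukirch1999, Ch. I §12] -/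
theorem index_range_units_map_mul_pow_eq [IsDiscreteValuationRing 𝒪[F]] [Finite 𝓀[F]]
    (R : Subring (Fin n → 𝒪[F])) [IsLocalRing R] (hconst : ∀ a : 𝒪[F], (fun _ : Fin n => a) ∈ R)
    (hfin : R.toAddSubgroup.index ≠ 0) :
    (Units.map (R.subtype : R →* (Fin n → 𝒪[F]))).range.index * Nat.card 𝓀[F] ^ (n - 1) =
      (Nat.card 𝓀[F] - 1) ^ (n - 1) * R.toAddSubgroup.index := by
  classical
  -- a uniformizer
  obtain ⟨ϖ₀, hirr⟩ := IsDiscreteValuationRing.exists_irreducible 𝒪[F]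
  have hϖ : IsUniformizingElement (ϖ₀ : F) :=
    ⟨ϖ₀.2, fun h => hirr.ne_zero (Subtype.ext h), by rw [(IsDiscreteValuationRing.irreducible_iff_uniformizer _).mp hirr]⟩
  set π : 𝒪[F] := ⟨(ϖ₀ : F), hϖ.mem⟩ with hπdef
  have hπmax : π ∈ IsLocalRing.maximalIdeal 𝒪[F] := by
    rw [← hϖ.span_coe_eq_maximalIdeal]; exact Ideal.mem_span_singleton_self _
  -- the conductor contains `𝔣 = π^m 𝒪ⁿ`, `m ≥ 1`
  obtain ⟨m, hm, hmR⟩ := exists_forall_pow_dvd_imp_mem hπmax R hconst hfin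
  set 𝔣 : Ideal (Fin n → 𝒪[F]) := Ideal.span ({fun _ : Fin n => π ^ m} : Set (Fin n → 𝒪[F])) with h𝔣def
  have h𝔣R : (𝔣 : Set (Fin n → 𝒪[F])) ⊆ R := fun x hx => hmR x ((mem_span_const_iff _ x).1 hx)
  have h𝔣J : 𝔣 ≤ Ideal.jacobson ⊥ := by
    intro x hx
    rw [Ideal.mem_jacobson_bot]
    intro y
    have hxi := (mem_span_const_iff _ x).1 hx
    refine Pi.isUnit_iff.2 fun i => ?_
    have hmem : x i * y i ∈ IsLocalRing.maximalIdeal 𝒪[F] := by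
      refine Ideal.mul_mem_right _ _ ?_
      obtain ⟨c, hc⟩ := hxi i
      rw [hc]
      exact Ideal.mul_mem_right _ _ (Ideal.pow_mem_of_mem _ hπmax _ hm)
    rw [← IsLocalRing.jacobson_eq_maximalIdeal ⊥ bot_ne_top, Ideal.mem_jacobson_bot] at hmem
    simpa using hmem 1
  -- Layer A
  have hA := index_range_units_map_mul_natCard_units_quotient R 𝔣 h𝔣R h𝔣J
  -- the `𝒪ⁿ` side
  have hOu : Nat.card ((Fin n → 𝒪[F]) ⧸ 𝔣)ˣ = (Nat.card 𝓀[F] ^ (m - 1) * (Nat.card 𝓀[F] - 1)) ^ n :=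
    natCard_units_quotient_span_const_pow hϖ hm
  have hO : Nat.card ((Fin n → 𝒪[F]) ⧸ 𝔣) = Nat.card 𝓀[F] ^ (m * n) := natCard_quotient_span_const_pow hϖ m
  -- the `R` side
  set 𝔣R : Ideal R := Ideal.comap R.subtype 𝔣 with h𝔣Rdef
  have hadd : Nat.card (R ⧸ 𝔣R) * R.toAddSubgroup.index = Nat.card 𝓀[F] ^ (m * n) := by
    rw [← hO]; exact natCard_quotient_comap_subtype_mul_index R 𝔣 h𝔣R
  have hq : 1 < Nat.card 𝓀[F] := Finite.one_lt_card
  have h𝔣Rtop : 𝔣R ≠ ⊤ := by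
    intro htop
    have h1 : (1 : R) ∈ 𝔣R := htop ▸ Submodule.mem_top
    rw [h𝔣Rdef, Ideal.mem_comap, map_one] at h1
    have hn : 0 < n := pos_of_isLocalRing_subring_pi R
    obtain ⟨c, hc⟩ := (mem_span_const_iff _ _).1 h1 ⟨0, hn⟩
    have hunit : IsUnit (π ^ m) := IsUnit.of_mul_eq_one c (by rw [← hc]; rfl)
    exact (IsLocalRing.mem_maximalIdeal _ |>.1 (Ideal.pow_mem_of_mem _ hπmax _ hm)) hunit
  haveI : Nontrivial (R ⧸ 𝔣R) := Ideal.Quotient.nontrivial_iff.2 h𝔣Rtop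
  haveI : IsLocalRing (R ⧸ 𝔣R) := IsLocalRing.of_surjective' (Ideal.Quotient.mk 𝔣R) Ideal.Quotient.mk_surjective
  haveI : Finite (R ⧸ 𝔣R) := by
    apply Nat.finite_of_card_ne_zero
    intro h0
    rw [h0, zero_mul] at hadd
    exact pow_ne_zero _ (by omega) hadd.symm
  have hresR : Nat.card (IsLocalRing.ResidueField (R ⧸ 𝔣R)) = Nat.card 𝓀[F] := by
    rw [natCard_residueField_quotient_eq, natCard_residueField_subring_pi_eq R hconst]
  have hB := natCard_units_mul_natCard_residueField (Λ := R ⧸ 𝔣R)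
  rw [hresR] at hB
  rw [hOu] at hA
  -- arithmetic: `U·X = (q^{m−1}(q−1))^n`, `X·q = A·(q−1)`, `A·I = q^{mn}` ⇒ `U·q^{n−1} = (q−1)^{n−1}·I`
  obtain ⟨n', rfl⟩ : ∃ n', n = n' + 1 := ⟨n - 1, (Nat.succ_pred_eq_of_pos (pos_of_isLocalRing_subring_pi R)).symm⟩
  obtain ⟨m', rfl⟩ : ∃ m', m = m' + 1 := ⟨m - 1, (Nat.succ_pred_eq_of_pos hm).symm⟩
  obtain ⟨p, hp⟩ : ∃ p, Nat.card 𝓀[F] = p + 1 := ⟨Nat.card 𝓀[F] - 1, by omega⟩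
  set U := (Units.map (R.subtype : R →* (Fin (n' + 1) → 𝒪[F]))).range.index
  set X := Nat.card (R ⧸ 𝔣R)ˣ
  set A := Nat.card (R ⧸ 𝔣R)
  set I := R.toAddSubgroup.index
  rw [hp] at hA hB hadd ⊢
  simp only [Nat.add_sub_cancel] at hA hB ⊢
  have hAp : 0 < A * p := Nat.mul_pos Nat.card_pos (by omega)
  refine Nat.eq_of_mul_eq_mul_right hAp ?_
  have lhs : U * (p + 1) ^ n' * (A * p) = p ^ (n' + 1) * (p + 1) ^ ((m' + 1) * (n' + 1)) := by
    calc U * (p + 1) ^ n' * (A * p) = U * (p + 1) ^ n' * (X * (p + 1)) := by rw [hB]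
      _ = (U * X) * (p + 1) ^ (n' + 1) := by ring
      _ = ((p + 1) ^ m' * p) ^ (n' + 1) * (p + 1) ^ (n' + 1) := by rw [hA]
      _ = p ^ (n' + 1) * (p + 1) ^ ((m' + 1) * (n' + 1)) := by ring
  have rhs : p ^ n' * I * (A * p) = p ^ (n' + 1) * (p + 1) ^ ((m' + 1) * (n' + 1)) := by
    calc p ^ n' * I * (A * p) = p ^ (n' + 1) * (A * I) := by ring
      _ = p ^ (n' + 1) * (p + 1) ^ ((m' + 1) * (n' + 1)) := by rw [hadd]
  exact lhs.trans rhs.symm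

/-- **O2 «UNIT INDEX OF A LOCAL ORDER», `q^S` form (DESIGN v1 §2: `(q_k − 1)^{n−1} q_k^{S−n+1}`).**  With `[𝒪ⁿ : R] = q^S`: `n − 1 ≤ S` (coprimality of `q` and `q − 1`) and
**`[(𝒪^×)ⁿ : R^×] = (q − 1)^{n−1} q^{S−(n−1)}`** — the shape O4 (★ `Literature.RingTheory.GaloisAlgebras.relIndex_comap_eq_of_index_eq`, `a = n − 1`, `T = S − (n−1)`) consumes.
[cite: Neukirch1999, Ch. I §12] -/
theorem index_range_units_map_eq_of_index_eq_pow [IsDiscreteValuationRing 𝒪[F]] [Finite 𝓀[F]]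
    (R : Subring (Fin n → 𝒪[F])) [IsLocalRing R] (hconst : ∀ a : 𝒪[F], (fun _ : Fin n => a) ∈ R) {S : ℕ}
    (hS : R.toAddSubgroup.index = Nat.card 𝓀[F] ^ S) :
    n - 1 ≤ S ∧ (Units.map (R.subtype : R →* (Fin n → 𝒪[F]))).range.index =
      (Nat.card 𝓀[F] - 1) ^ (n - 1) * Nat.card 𝓀[F] ^ (S - (n - 1)) := by
  have hq : 1 < Nat.card 𝓀[F] := Finite.one_lt_card
  have hfin : R.toAddSubgroup.index ≠ 0 := by rw [hS]; exact pow_ne_zero _ (by omega)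
  have h := index_range_units_map_mul_pow_eq R hconst hfin
  rw [hS] at h
  have hcop : Nat.Coprime (Nat.card 𝓀[F] ^ (n - 1)) ((Nat.card 𝓀[F] - 1) ^ (n - 1)) :=
    Nat.Coprime.pow _ _ ((Nat.coprime_self_sub_right (by omega)).2 (Nat.coprime_one_right _))
  have hdvd : Nat.card 𝓀[F] ^ (n - 1) ∣ (Nat.card 𝓀[F] - 1) ^ (n - 1) * Nat.card 𝓀[F] ^ S :=
    ⟨(Units.map (R.subtype : R →* (Fin n → 𝒪[F]))).range.index, by rw [← h, mul_comm]⟩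
  have hle : n - 1 ≤ S := (Nat.pow_dvd_pow_iff_le_right hq).1 (hcop.dvd_of_dvd_mul_left hdvd)
  refine ⟨hle, ?_⟩
  obtain ⟨t, ht⟩ := Nat.exists_eq_add_of_le hle
  rw [ht, Nat.add_sub_cancel_left]
  rw [ht, pow_add] at h
  apply Nat.eq_of_mul_eq_mul_right (pow_pos (by omega : 0 < Nat.card 𝓀[F]) (n - 1))
  rw [h]; ring

end UnitIndex


end Literature.NumberTheory.Automorphic

end
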